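import Summits.BirchSwinnertonDyer.BirchSwinnertonDyer.Theorems.ResidualThetaTransportAtTwoResidualThetaMainConjectureAtTwoLayerMuReading
import Summits.BirchSwinnertonDyer.BirchSwinnertonDyer.Theorems.ByReductionTypeAtTwoSupersingularUnitAnchorTransportMC
import Summits.BirchSwinnertonDyer.BirchSwinnertonDyer.Theorems.ThetaPartnerAtTwoSignedMainConjectureCMTwoPeriodUnit
import Summits.BirchSwinnertonDyer.Rank1Residual.Supersingular.MazurTateReduction
import HarnessLib

/-!
# Crux `SupersingularRankZeroAtTwo` (item stmt-BirchSwinnertonDyer-19097, route `ByReductionTypeAtTwo`, rung K4): the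
# MAZUR–TATE READING DOOR at `2` — the analytic CERT binder `hCert` («μ(ϖL♭_W) = 0 ∧ λ(ϖL♭_W) ≤ ℓ») of the `Λ`-form
# displays becomes KERNEL (route RTT's layer reading, consumed BY NAME) ∘ PUB (Abbes–Ullmo at `2`) ∘ a FINITE certificate
# «μ_n(θ_n(f)) = 0 ∧ λ_n(θ_n(f)) = (2ⁿ−1)/3 + ℓ» on ONE Mazur–Tate element; p560616's `Λ`-form doors re-keyed
# (seat `bsd-2adic-ss-1x` GEN 5)

HONEST FRAMING (cells `bsd-2adic` / `bsd-wall`; HUMAN RULINGS D-0036/D-0054/D-0074): THEOREMS ONLY — no definition, no named fact,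
no instance, no `sorry`; every research input is an explicit hypothesis spelled inline; closes no item; BSD is NOT proved by any
of this. PARTITION (D-0054): X5@2 good-supersingular `a₂ = 0` (the `Λ`-form unit-anchor / theta-habitat displays) × `p = 2` —
types-the-object-of; bears_on K4 19097 · TP2 K3 (analytic currency `L♭`, `θ_n`) · RTT 20787 (its kernel layer reading, imported).

WHAT. Every `Λ`-form display of GEN 4 (p560616) carries ONE analytic CERT binder `hCert`: «for every integral multiple `G`,
`ι G = 2^m ϖ ι L♭_W`, `mu G = m ∧ lam G ≤ ℓ`» (`μ(ϖL♭_W) = 0`, `λ(ϖL♭_W) ≤ ℓ` — a statement about a LIMIT object, inhabited per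
class by an ENGINE reading, kit j248632). The reading is elementary `Λ`-algebra and ALREADY a theorem of the tree on route
`ResidualThetaTransportAtTwo` (cell `bsd-wall`, crux 20787): `ResidualThetaLayer.exists_integralModel_mazurTateElement_two`
(`θ_n(f) = 2^{μ(L⁻)}·P`, `P ≡ ±T^{(2ⁿ−1)/3}·(L⁻/2^{μ}) (mod 2, T^{2ⁿ})`, from Pollack's even-level congruence — a conjunct of the
binder `IsPollackPair f 2 L⁺ L⁻`) and `…mu_eq_zero_of_supNorm_mazurTateElement_two_eq_one`; CONSUMED here BY NAME (no re-typing):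
* §1 `mu_eq_zero_and_lam_eq_of_layerCertificate_two` — for ANY weight-2 cusp form `f` with a Pollack pair at `2`, ONE even layer
  `n` with `supNorm θ_n(f) = 1` (`μ_n = 0`) and Pollack–Weston `layerLambda θ_n(f) = (2ⁿ−1)/3 + ℓ` (`θ_n(f) ∈ ℚ[T] ⊂ ℚ̄₂[T]`) gives
  `μ(L⁻) = 0 ∧ λ(L⁻) = ℓ` EXACTLY — the converse of RTT's `layerLambda_mazurTateElement_two_of_isPollackPair` (which needs
  `n ≥ 2λ(L⁻)+2`), with NO a-priori bound on `λ(L⁻)` (the unit coefficient sits below `deg θ_n < 2ⁿ`); small `Λ`-glue reused from `Supersingular/MazurTateReduction`;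
* §2 `reading_two_of_layerCertificate` — `hCert` of p560616 VERBATIM (indeed `lam G = ℓ`) from PUB `h2`
  (`realPeriodRat_eq_unit_mul_plusPeriod_two`, `|ϖ|₂ = 1`: Abbes–Ullmo Thm. A ∘ Greenberg–Vatsal Rem. 3.4, audited fe527f92) and the
  FINITE certificate `hMT` «`supNorm θ_n(f) = 1 ∧ layerLambda θ_n(f) = (2ⁿ−1)/3 + ℓ`» at ONE even `n` — a statement about the `2ⁿ`
  modular symbols `[a/2^{n+2}]⁺_f` (finitely many special values; two-engine reproducible: ENGINE-1 j129299 / ENGINE-2 j248632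
  columns `μ(θ_n)`, `λ(θ_n)`), invariant under the `2`-adic unit `ϖ`, instead of a reading of the limit `L♭`;
* §3 the `Λ`-form doors of p560616 RE-KEYED: `kobayashiMainConjecture_two_of_unitAnchor_of_mazurTate`,
  `bsdp_two_of_unitAnchor_of_mazurTate` (binders: GEN 4's minus `hCert`, plus `h2`, `hMT`; `ℓ` = the census numeral `ℓ*`).
Honest tag of the `a₂ = 0` unit-anchor `Λ`-form displays after this file: CERT {ENGINE reading of (μ,λ)(ϖL♭_W)} ↦ PUB {h2} +
CERT {(μ_n, λ_n) of one Mazur–Tate element} + KERNEL; nothing is booked; BSD is not proved by any of this.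

References: [Pollack2003] Prop. 6.18; [PollackWeston2011MT] §3.1, §4; [AbbesUllmo1996] Thm. A; [GreenbergVatsal2000] §3 Rem. 3.4;
[Kobayashi2003] Thm. 1.2, Conjecture; [BDKim2009] Cor. 2.13; [BDKim2013] Cor. 3.15; [Kato2004Asterisque] Thm. 12.5 (3); [Miller2011LMS].
-/

set_option autoImplicit false
-- the Theorems namespace of this sub repeats the summit name by design (D-0017 nested layout)
set_option linter.dupNamespace false

noncomputable section

open scoped Classical MatrixGroups ModularForm

open CongruenceSubgroup Polynomial WeierstrassCurve Literature.NumberTheory.EllipticCurves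
  Literature.NumberTheory.EllipticCurves.ModularForms Literature.NumberTheory.EllipticCurves.Sprung2017
  Literature.NumberTheory.EllipticCurves.Rank1Residual Literature.NumberTheory.EllipticCurves.Rank1Residual.Typed
  Literature.NumberTheory.EllipticCurves.Kobayashi2003 Literature.NumberTheory.EllipticCurves.IwasawaDual
  Literature.NumberTheory.IwasawaTheory
  ZpExtension Summit.BirchSwinnertonDyer.Rank1Residual Summit.BirchSwinnertonDyer.Rank1Residual.Supersingular
  Summit.BirchSwinnertonDyer.Rank1Residual.X5.O1 Summit.BirchSwinnertonDyer.Rank1Residual.X1.MuLambda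

namespace Summit.BirchSwinnertonDyer.BirchSwinnertonDyer.Theorems
namespace SSMazurTate

/-! ## §1 `Λ`-glue and the layer certificate ⇒ `μ(L⁻) = 0`, `λ(L⁻) = ℓ` -/

section Algebra

variable {p : ℕ} [Fact p.Prime]

/-- **Scaling.** `G = p^m · G₀` with `G₀ ≢ 0 (mod p)`: `μ(G) = m`, `λ(G) = λ(G₀)`. [folklore] -/
theorem mu_lam_of_eq_C_pow_mul {G G₀ : IwasawaAlgebra p} {m : ℕ} (h : G = PowerSeries.C ((p : ℤ_[p]) ^ m) * G₀)
    (h₀ : red G₀ ≠ 0) : mu G = m ∧ lam G = lam G₀ := by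
  obtain ⟨hμ, hpf⟩ := mu_eq_and_pfree_eq h₀ h
  obtain ⟨-, hpf₀⟩ := mu_eq_and_pfree_eq (g := G₀) (a := 0) h₀ (by simp)
  exact ⟨hμ, by rw [lam, lam, hpf, hpf₀]⟩

/-- `μ` and `λ` are unchanged by a unit constant: `μ(C u · L) = μ(L)`, `λ(C u · L) = λ(L)`. [folklore] -/
theorem mu_lam_C_unit_mul {u : ℤ_[p]} (hu : IsUnit u) {L : IwasawaAlgebra p} (hL : L ≠ 0) :
    mu (PowerSeries.C u * L) = mu L ∧ lam (PowerSeries.C u * L) = lam L := by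
  have hCu : IsUnit (PowerSeries.C u : IwasawaAlgebra p) := hu.map _
  obtain ⟨hCu0, hμu, hlu⟩ := (isUnit_iff_mu_eq_zero_and_lam_eq_zero _).mp hCu
  rw [mu_mul hCu0 hL, lam_mul hCu0 hL, hμu, hlu, zero_add, zero_add]
  exact ⟨rfl, rfl⟩

end Algebra

section Layer

variable {N : ℕ} (f : CuspForm (Gamma0 N) 2) {Lplus Lminus : IwasawaAlgebra 2}

/-- **ONE Mazur–Tate layer certifies `μ(L⁻) = 0` AND `λ(L⁻) = ℓ`.** For any weight-2 cusp form `f` on `Γ₀(N)` with a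
Pollack pair `(L⁺, L⁻)` at `2` and ONE even `n`: if `θ_n(f)` (read in `ℚ̄₂[T]`) has `supNorm = 1` (`μ_n = 0`) and Pollack–Weston
layer `λ` equal to `(2ⁿ − 1)/3 + ℓ`, then `μ(L⁻) = 0` and `λ(L⁻) = ℓ`. Proof: RTT's integral model
`θ_n = 2^{μ(L⁻)}·P`, `P ≡ ±T^{(2ⁿ−1)/3}·L₀ (mod 2, T^{2ⁿ})` (`exists_integralModel_mazurTateElement_two`, BY NAME); `supNorm = 1`
forces `μ(L⁻) = 0` (`mu_eq_zero_of_supNorm_mazurTateElement_two_eq_one`, BY NAME); the layer `λ` says `|P_j| < 1` for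
`j < (2ⁿ−1)/3 + ℓ` and `|P_{(2ⁿ−1)/3+ℓ}| = 1`, and `(2ⁿ−1)/3 + ℓ ≤ deg θ_n < 2ⁿ`, so `ord_T(L₀ mod 2) = ℓ = λ(L⁻)`. The converse
of RTT's `layerLambda_mazurTateElement_two_of_isPollackPair`, with NO a-priori bound on `λ(L⁻)`.
[cite: Pollack2003, Prop. 6.18] [cite: PollackWeston2011MT, §3.1 and §4] -/
theorem mu_eq_zero_and_lam_eq_of_layerCertificate_two (hPP : IsPollackPair f 2 Lplus Lminus) {n : ℕ} (heven : Even n)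
    {ℓ : ℕ} (hμ : ((mazurTateElement f 2 n).map (algebraMap ℚ (PadicAlgCl 2))).supNorm = 1)
    (hlayn : layerLambda ((mazurTateElement f 2 n).map (algebraMap ℚ (PadicAlgCl 2))) = (2 ^ n - 1) / 3 + ℓ) :
    mu Lminus = 0 ∧ lam Lminus = ℓ := by
  have hLm : Lminus ≠ 0 := hPP.2.1
  have hmu0 : mu Lminus = 0 := ResidualThetaLayer.mu_eq_zero_of_supNorm_mazurTateElement_two_eq_one f hPP heven hμ
  refine ⟨hmu0, ?_⟩
  set φ : ℤ_[2] →+* PadicAlgCl 2 := (algebraMap ℚ_[2] (PadicAlgCl 2)).comp (algebraMap ℤ_[2] ℚ_[2]) with hφdef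
  have hφ : ∀ x, ‖φ x‖ = ‖x‖ := ResidualThetaLayer.norm_algebraMap_padicInt_padicAlgCl
  obtain ⟨P, hθP, hcoeff⟩ := ResidualThetaLayer.exists_integralModel_mazurTateElement_two f hPP heven
  set θ' : (PadicAlgCl 2)[X] := (mazurTateElement f 2 n).map (algebraMap ℚ (PadicAlgCl 2)) with hθ'
  have hθP' : θ' = P.map φ := by rw [hθP, hmu0, pow_zero, C_1, one_mul]
  set d : ℕ := (2 ^ n - 1) / 3 with hd
  -- the layer `λ` read on `P`: `|P_j| < 1` below `d + ℓ`, `|P_{d+ℓ}| = 1`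
  have hlay := (layerLambda_eq_iff.mp hlayn)
  rw [hμ] at hlay
  obtain ⟨hat, hbelow⟩ := hlay
  have hnormP : ∀ j, ‖θ'.coeff j‖ = ‖P.coeff j‖ := fun j ↦ by rw [hθP', coeff_map, hφ]
  have hPat : PadicInt.toZMod (P.coeff (d + ℓ)) ≠ 0 := by
    intro h0
    rw [← RingHom.mem_ker, PadicInt.ker_toZMod, IsLocalRing.mem_maximalIdeal, PadicInt.mem_nonunits, ← hnormP, hat] at h0
    exact lt_irrefl _ h0
  have hPbelow : ∀ j < d + ℓ, PadicInt.toZMod (P.coeff j) = 0 := fun j hj ↦ by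
    rw [← RingHom.mem_ker, PadicInt.ker_toZMod, IsLocalRing.mem_maximalIdeal, PadicInt.mem_nonunits, ← hnormP]
    exact hbelow j hj
  -- `d + ℓ < 2ⁿ`: the coefficient of `θ_n` at `d + ℓ` is non-zero and `deg θ_n < 2ⁿ`
  have hdl : d + ℓ < 2 ^ n := by
    have hne : θ'.coeff (d + ℓ) ≠ 0 := by
      intro h0; rw [h0, norm_zero] at hat; exact zero_ne_one hat
    have hne' : (mazurTateElement f 2 n).coeff (d + ℓ) ≠ 0 := by
      intro h0; apply hne; rw [hθ', coeff_map, h0, map_zero]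
    exact lt_of_le_of_lt (le_natDegree_of_ne_zero hne') (natDegree_mazurTateElement_lt f 2 n)
  -- read `ord_T (L₀ mod 2) = ℓ`
  have hu : ((-1 : ZMod 2) ^ (n / 2 + 1)) ≠ 0 := pow_ne_zero _ (neg_ne_zero.mpr one_ne_zero)
  have hord := ResidualThetaLayer.order_map_toZMod_pfree_eq_lam hLm
  rw [PowerSeries.order_eq_nat] at hord
  obtain ⟨hlamne, hlamlt⟩ := hord
  apply le_antisymm
  · -- `λ(L⁻) ≤ ℓ`: the coefficient `ℓ` of `L₀ mod 2` is non-zero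
    by_contra hlt
    push Not at hlt
    have h1 := hcoeff (d + ℓ) hdl
    rw [if_pos (Nat.le_add_right d ℓ), Nat.add_sub_cancel_left, hlamlt ℓ hlt, mul_zero] at h1
    exact hPat h1
  · -- `ℓ ≤ λ(L⁻)`: the coefficients of `L₀ mod 2` below `ℓ` vanish
    by_contra hlt
    push Not at hlt
    have h1 := hcoeff (d + lam Lminus) (by omega)
    rw [if_pos (Nat.le_add_right d _), Nat.add_sub_cancel_left, hPbelow _ (by omega)] at h1
    exact hlamne ((mul_eq_zero.mp h1.symm).resolve_left hu)

end Layer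

/-! ## §2 `p = 2`, sign `+`/`♭`: the CERT binder `hCert` of the `Λ`-form displays from `h2` + ONE layer certificate -/

section Two

variable (W : WeierstrassCurve ℚ) [W.IsElliptic] [W.IsGloballyMinimal]

/-- **`|ϖ|₂ = 1` for the period ratio at a good supersingular `2`** (granted `h2` = Abbes–Ullmo at `2` BY NAME): for `W`
good supersingular at `2` (so `W[2]` is irreducible, `P2.irr_two_of_goodSS_two`), a newform `f` of `W` and `ϖ·Ω_W = Ω⁺_f`,
`ϖ = u⁻¹` with `|u|₂ = 1`. (Norm form of tp2-p2's `padicValRat_periodRatio_eq_zero_two`.)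
[cite: AbbesUllmo1996, Thm. A] [cite: GreenbergVatsal2000, §3, Remark 3.4] -/
theorem norm_periodRatio_eq_one_two (h2 : realPeriodRat_eq_unit_mul_plusPeriod_two) (hss : GoodSS W 2)
    {N : ℕ} [NeZero N] {f : CuspForm (Gamma0 N) 2} (hf : IsNewformOf W f)
    {ϖ : ℚ} (hϖ : (ϖ : ℝ) * W.realPeriodRat = plusPeriod f) : ‖(ϖ : ℚ_[2])‖ = 1 := by
  obtain ⟨u, hu1, hΩ⟩ := h2 W hss.1 (P2.irr_two_of_goodSS_two W hss) f hf
  have hΩpos : 0 < W.realPeriodRat := W.realPeriodRat_pos_holds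
  have hP0 : plusPeriod f ≠ 0 := fun h0 ↦ by rw [h0, mul_zero] at hΩ; exact hΩpos.ne' hΩ
  have hϖu : ((ϖ * u : ℚ) : ℝ) = 1 := by
    have h : (ϖ : ℝ) * ((u : ℝ) * plusPeriod f) = 1 * plusPeriod f := by rw [← hΩ, hϖ, one_mul]
    rw [← mul_assoc] at h
    exact_mod_cast mul_right_cancel₀ hP0 h
  have h : ‖((ϖ * u : ℚ) : ℚ_[2])‖ = 1 := by rw [show ϖ * u = 1 by exact_mod_cast hϖu]; simp
  rwa [Rat.cast_mul, norm_mul, hu1, mul_one] at h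

/-- **THE MAZUR–TATE READING DOOR at `2` (sign `+`/`♭`).** For `W` good supersingular at `2`, granted the PUB fact `h2`
(`realPeriodRat_eq_unit_mul_plusPeriod_two`: `|ϖ|₂ = 1`) and the LAYER CERTIFICATE `hMT` at ONE even level `n` — for the
newform `f` of `W`, `θ_n(f) = mazurTateElement f 2 n` read in `ℚ̄₂[T]` has `supNorm = 1` (`μ_n(θ_n) = 0`: some modular symbol
`[a/2^{n+2}]⁺_f`-combination is a `2`-adic unit, all are integral) and Pollack–Weston layer `λ` equal to `(2ⁿ−1)/3 + ℓ` — the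
CERT binder `hCert` of the `Λ`-form displays (p560616) holds with EQUALITY: for every Pollack pair `(L⁺, L⁻)` of `f` at `2`
and every integral multiple `G`, `ι G = 2^m ϖ ι L⁻`, `μ(G) = m` and `λ(G) = ℓ`. Chain: §1 (`μ(L⁻) = 0`, `λ(L⁻) = ℓ`, via
RTT's kernel layer reading BY NAME) + `|ϖ|₂ = 1` ⇒ `G = 2^m·(ϖL⁻)` with `ϖL⁻ ≢ 0 (mod 2)`. The binders `κ, γ` are idle (kept so
that the conclusion is `hCert` VERBATIM). [cite: Pollack2003, Prop. 6.18] [cite: PollackWeston2011MT, §3.1]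
[cite: AbbesUllmo1996, Thm. A] -/
theorem reading_two_of_layerCertificate (h2 : realPeriodRat_eq_unit_mul_plusPeriod_two) (hss : GoodSS W 2)
    {n : ℕ} (hn : Even n) (ℓ : ℕ)
    (hMT : ∀ [NeZero (W.conductorNorm ℤ)] (f : CuspForm (Gamma0 (W.conductorNorm ℤ)) 2), IsNewformOf W f →
      ((mazurTateElement f 2 n).map (algebraMap ℚ (PadicAlgCl 2))).supNorm = 1 ∧
        layerLambda ((mazurTateElement f 2 n).map (algebraMap ℚ (PadicAlgCl 2))) = (2 ^ n - 1) / 3 + ℓ) :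
    ∀ (κ : ZpExtension ℚ 2) (γ : Field.absoluteGaloisGroup ℚ),
        κ.IsCyclotomic → κ.IsTopGenerator γ → IsCyclotomicVariable 2 γ →
        ∀ [NeZero (W.conductorNorm ℤ)] (f : CuspForm (Gamma0 (W.conductorNorm ℤ)) 2),
          IsNewformOf W f → ∀ (ϖ : ℚ), (ϖ : ℝ) * W.realPeriodRat = plusPeriod f →
        ∀ (Lplus Lminus : IwasawaAlgebra 2), IsPollackPair f 2 Lplus Lminus →
        ∀ (G : IwasawaAlgebra 2) (m : ℕ), iwasawaToPowerSeries 2 G =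
            PowerSeries.C ((2 : ℚ_[2]) ^ m * (ϖ : ℚ_[2])) * iwasawaToPowerSeries 2 (kobayashiL 1 Lplus Lminus) →
          mu G = m ∧ lam G = ℓ := by
  intro κ γ _ _ _ _ f hf ϖ hϖ Lplus Lminus hPP G m hG
  obtain ⟨hμn, hlayn⟩ := hMT f hf
  obtain ⟨hμ, hl⟩ := mu_eq_zero_and_lam_eq_of_layerCertificate_two f hPP hn hμn hlayn
  have hLm : Lminus ≠ 0 := hPP.2.1
  -- `ϖ` is a `2`-adic unit (Abbes–Ullmo, `h2`)
  have hϖ1 : ‖(ϖ : ℚ_[2])‖ = 1 := norm_periodRatio_eq_one_two W h2 hss hf hϖ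
  set c' : ℤ_[2] := ⟨(ϖ : ℚ_[2]), hϖ1.le⟩ with hc'
  have hcu : IsUnit c' := PadicInt.isUnit_iff.mpr hϖ1
  -- `G = 2^m · (c' · L⁻)` in `Λ`
  have hK : kobayashiL (1 : ℤˣ) Lplus Lminus = Lminus := if_pos rfl
  have hGeq : G = PowerSeries.C ((2 : ℤ_[2]) ^ m) * (PowerSeries.C c' * Lminus) := by
    apply iwasawaToPowerSeries_injective 2
    rw [hG, hK, map_mul (iwasawaToPowerSeries 2), map_mul (iwasawaToPowerSeries 2), iwasawaToPowerSeries,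
      PowerSeries.map_C, PowerSeries.map_C, ← mul_assoc, ← map_mul, map_pow, PadicInt.algebraMap_apply,
      PadicInt.algebraMap_apply]
    rfl
  obtain ⟨hμc, hlc⟩ := mu_lam_C_unit_mul hcu hLm
  have hred : red (PowerSeries.C c' * Lminus) ≠ 0 :=
    red_ne_zero_of_mu_eq_zero (mul_ne_zero (hcu.map (PowerSeries.C (R := ℤ_[2]))).ne_zero hLm) (by rw [hμc, hμ])
  have h2m : PowerSeries.C ((2 : ℤ_[2]) ^ m) = PowerSeries.C (((2 : ℕ) : ℤ_[2]) ^ m) := by rw [Nat.cast_ofNat]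
  rw [h2m] at hGeq
  obtain ⟨hμG, hlG⟩ := mu_lam_of_eq_C_pow_mul hGeq hred
  exact ⟨hμG, by rw [hlG, hlc, hl]⟩

end Two

/-! ## §3 The `Λ`-form unit-anchor doors of p560616 RE-KEYED: `hCert` ↦ (`h2`, Mazur–Tate certificate) -/

section Rekey

variable (W : WeierstrassCurve ℚ) [W.IsElliptic] [W.IsGloballyMinimal]
  (A : WeierstrassCurve ℚ) [A.IsElliptic] [A.IsGloballyMinimal]

/-- **UNIT-ANCHOR TRANSPORT, `Λ`-form, Mazur–Tate keyed: Kobayashi's `+` main conjecture at `2` for `W`.** The door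
`SSUnitAnchor.kobayashiMainConjecture_two_of_unitAnchor` (p560616) with its analytic CERT binder `hCert` («`μ(ϖL♭_W) = 0 ∧
λ(ϖL♭_W) ≤ ℓ`», a reading of the limit object) REPLACED by PUB `h2` (Abbes–Ullmo at `2`) and the layer certificate of
`reading_two_of_layerCertificate` at one even level `n` (`μ_n(θ_n(f)) = 0`, `λ_n(θ_n(f)) = (2ⁿ−1)/3 + ℓ`, `ℓ` = the census numeral `ℓ*`). All other
binders VERBATIM as in p560616 (PUB `hmod hGZK h124 hX0`; RESEARCH at the pair `hEC hCK hECA hmuT hlamT`; CERT: unit zone of `A`,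
`W[2] ≃ A[2]`). [cite: Pollack2003, Prop. 6.18] [cite: BDKim2009, Cor. 2.13] [cite: Kobayashi2003, Thm. 1.2 and Conjecture (p. 2)]
[cite: Kato2004Asterisque, Thm. 12.5 (3)] [cite: AbbesUllmo1996, Thm. A] -/
theorem kobayashiMainConjecture_two_of_unitAnchor_of_mazurTate (hmod : nonempty_modularParametrizationData)
    (hGZK : rank_eq_analyticRank_of_analyticRank_le_one)
    (h124 : Kato2004.thm12_4) (hX0 : Kato2004_fineSelmerDual_isTorsion)
    (h2 : realPeriodRat_eq_unit_mul_plusPeriod_two)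
    (hr : W.analyticRank = 0) (hss : GoodSS W 2) (ha : W.frobeniusTrace 2 = 0)
    (hAr : A.analyticRank = 0) (hAss : GoodSS A 2) (hAa : A.frobeniusTrace 2 = 0)
    (hTam : ¬ 2 ∣ A.tamagawaProduct) (hSha : ¬ 2 ∣ A.shaOrder)
    (e : WeierstrassCurve.geomTorsion W (2 : ℤ) ≃+ WeierstrassCurve.geomTorsion A (2 : ℤ))
    (he : ∀ (σ : Field.absoluteGaloisGroup ℚ) (P : WeierstrassCurve.geomTorsion W (2 : ℤ)), e (σ • P) = σ • e P)
    (hEC : ∀ (κ : ZpExtension ℚ 2) (γ : Field.absoluteGaloisGroup ℚ),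
          κ.IsCyclotomic → κ.IsTopGenerator γ → Finite (W.selmerGroupPInfty 2) →
          Finite (endInvariants (conjSignedSelmerInfty W κ 1 γ - 1)) ∧
            ∃ u : ℤ_[2]ˣ, (Nat.card (endInvariants (conjSignedSelmerInfty W κ 1 γ - 1)) : ℚ_[2]) =
              ((u : ℤ_[2]) : ℚ_[2]) * ((2 : ℕ) : ℚ_[2]) ^ (padicValNat 2 W.tamagawaProduct) *
                (Nat.card (W.selmerGroupPInfty 2) : ℚ_[2]) *
                  (Nat.card (EndCoinvariants (conjSignedSelmerInfty W κ 1 γ - 1)) : ℚ_[2]))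
    (hCK : ∀ (κ : ZpExtension ℚ 2) (γ : Field.absoluteGaloisGroup ℚ),
        κ.IsCyclotomic → κ.IsTopGenerator γ → IsCyclotomicVariable 2 γ →
        ∀ [NeZero (W.conductorNorm ℤ)] (f : CuspForm (Gamma0 (W.conductorNorm ℤ)) 2),
          IsNewformOf W f → ∀ (ϖ : ℚ), (ϖ : ℝ) * W.realPeriodRat = plusPeriod f →
        ∀ (Lplus Lminus : IwasawaAlgebra 2), IsPollackPair f 2 Lplus Lminus →
        ∀ (D : SignedSelmerDualData W κ γ 1) [ContinuousSMul ℤ_[2] (W.tateModule 2)],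
          ∃ (I : Kato2004.IwasawaH1Data W 2 κ γ) (Y : W.FineSelmerDualData κ γ)
            (P : Submodule (IwasawaAlgebra 2) (IwasawaAlgebra 2))
            (loc : I.H →ₗ[IwasawaAlgebra 2] P) (toX : P →ₗ[IwasawaAlgebra 2] D.X)
            (δ : D.X →ₗ[IwasawaAlgebra 2] Y.X) (Z : Submodule (IwasawaAlgebra 2) I.H)
            (G : IwasawaAlgebra 2),
            Function.Exact loc toX ∧ Function.Exact toX δ ∧
            G ∈ Submodule.map (P.subtype ∘ₗ loc) Z ∧
            iwasawaToPowerSeries 2 G =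
              PowerSeries.C (ϖ : ℚ_[2]) * iwasawaToPowerSeries 2 (kobayashiL 1 Lplus Lminus) ∧
            (∀ 𝔭 : PrimeSpectrum (IwasawaAlgebra 2), 𝔭.asIdeal.height = 1 →
              PowerSeries.C (2 : ℤ_[2]) ∉ 𝔭.asIdeal →
              Literature.NumberTheory.EllipticCurves.Module.lengthAt (IwasawaAlgebra 2) Y.X 𝔭 ≤
                Literature.NumberTheory.EllipticCurves.Module.lengthAt (IwasawaAlgebra 2) (I.H ⧸ Z) 𝔭))
    (hECA : ∀ (κ : ZpExtension ℚ 2) (γ : Field.absoluteGaloisGroup ℚ),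
          κ.IsCyclotomic → κ.IsTopGenerator γ → Finite (A.selmerGroupPInfty 2) →
          Finite (endInvariants (conjSignedSelmerInfty A κ 1 γ - 1)) ∧
            ∃ u : ℤ_[2]ˣ, (Nat.card (endInvariants (conjSignedSelmerInfty A κ 1 γ - 1)) : ℚ_[2]) =
              ((u : ℤ_[2]) : ℚ_[2]) * ((2 : ℕ) : ℚ_[2]) ^ (padicValNat 2 A.tamagawaProduct) *
                (Nat.card (A.selmerGroupPInfty 2) : ℚ_[2]) *
                  (Nat.card (EndCoinvariants (conjSignedSelmerInfty A κ 1 γ - 1)) : ℚ_[2]))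
    (hmuT : GoodSS W 2 → W.frobeniusTrace 2 = 0 → GoodSS A 2 → A.frobeniusTrace 2 = 0 →
      (∃ e : WeierstrassCurve.geomTorsion W (2 : ℤ) ≃+ WeierstrassCurve.geomTorsion A (2 : ℤ),
        ∀ (σ : Field.absoluteGaloisGroup ℚ) (P : WeierstrassCurve.geomTorsion W (2 : ℤ)), e (σ • P) = σ • e P) →
      ∀ (κ : ZpExtension ℚ 2) (γ : Field.absoluteGaloisGroup ℚ), κ.IsCyclotomic → κ.IsTopGenerator γ →
      ∀ (D : SignedSelmerDualData W κ γ 1) (D' : SignedSelmerDualData A κ γ 1)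
        [Module.Finite (IwasawaAlgebra 2) D.X] [Module.Finite (IwasawaAlgebra 2) D'.X],
        Module.IsTorsion (IwasawaAlgebra 2) D.X → Module.IsTorsion (IwasawaAlgebra 2) D'.X →
        D'.mu = 0 → D.mu = 0)
    (ℓ : ℕ)
    (hlamT : GoodSS W 2 → W.frobeniusTrace 2 = 0 → GoodSS A 2 → A.frobeniusTrace 2 = 0 →
      (∃ e : WeierstrassCurve.geomTorsion W (2 : ℤ) ≃+ WeierstrassCurve.geomTorsion A (2 : ℤ),
        ∀ (σ : Field.absoluteGaloisGroup ℚ) (P : WeierstrassCurve.geomTorsion W (2 : ℤ)), e (σ • P) = σ • e P) →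
      ∀ (κ : ZpExtension ℚ 2) (γ : Field.absoluteGaloisGroup ℚ), κ.IsCyclotomic → κ.IsTopGenerator γ →
      ∀ (D : SignedSelmerDualData W κ γ 1) (D' : SignedSelmerDualData A κ γ 1)
        [Module.Finite (IwasawaAlgebra 2) D.X] [Module.Finite (IwasawaAlgebra 2) D'.X],
        Module.IsTorsion (IwasawaAlgebra 2) D.X → Module.IsTorsion (IwasawaAlgebra 2) D'.X →
        D.mu = 0 → D'.mu = 0 → lambdaInvariant 2 D.X = lambdaInvariant 2 D'.X + ℓ)
    {n : ℕ} (hn : Even n)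
    (hMT : ∀ [NeZero (W.conductorNorm ℤ)] (f : CuspForm (Gamma0 (W.conductorNorm ℤ)) 2), IsNewformOf W f →
      ((mazurTateElement f 2 n).map (algebraMap ℚ (PadicAlgCl 2))).supNorm = 1 ∧
        layerLambda ((mazurTateElement f 2 n).map (algebraMap ℚ (PadicAlgCl 2))) = (2 ^ n - 1) / 3 + ℓ) :
    KobayashiMainConjecture W 2 1 :=
  SSUnitAnchor.kobayashiMainConjecture_two_of_unitAnchor W A hmod hGZK h124 hX0 hr hss ha hAr hAss hAa hTam hSha e he hEC
    hCK hECA hmuT ℓ hlamT (by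
      intro κ γ hκ hγ hγ' _ f hf ϖ hϖ Lplus Lminus hPP G m hG
      obtain ⟨hμ, hl⟩ := reading_two_of_layerCertificate W h2 hss hn ℓ hMT κ γ hκ hγ hγ' f hf ϖ hϖ Lplus Lminus hPP G m hG
      exact ⟨hμ, hl.le⟩)

/-- **UNIT-ANCHOR TRANSPORT, `Λ`-form, Mazur–Tate keyed: BSD₂ for `W` with NO descent certificate and NO engine reading of `L♭`.**
`SSUnitAnchor.bsdp_two_of_unitAnchor_of_reading` (p560616) with `hCert` ↦ (`h2`, layer certificate `(μ_n, λ_n)(θ_n(f)) = (0, (2ⁿ−1)/3 + ℓ)` at one even level).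
Displayed research content: `hmuT`, `hlamT` (the two algebraic halves of TP2 K1 at `2`, at the pair), (2′) at `W` and `A`,
(4)ʳᵃᵗ at `W`; PUB: `hmod hGZK h124 hX0 h2`; CERT: unit zone of `A`, `W[2] ≃ A[2]`, and the layer invariants `(μ_n, λ_n)` of ONE
Mazur–Tate element `θ_n(f)` of `W` (a function of `2ⁿ` modular symbols — finitely many exact rationals). BSD is not proved by any of this; closes nothing by itself.
[cite: Kobayashi2003, Thm. 1.2 and Conjecture (p. 2)] [cite: BDKim2013, Cor. 3.15] [cite: BDKim2009, Cor. 2.13]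
[cite: Pollack2003, Prop. 6.18] [cite: AbbesUllmo1996, Thm. A] [cite: Miller2011LMS, Def. 1.1] -/
theorem bsdp_two_of_unitAnchor_of_mazurTate (hmod : nonempty_modularParametrizationData)
    (hGZK : rank_eq_analyticRank_of_analyticRank_le_one)
    (h124 : Kato2004.thm12_4) (hX0 : Kato2004_fineSelmerDual_isTorsion)
    (h2 : realPeriodRat_eq_unit_mul_plusPeriod_two)
    (hr : W.analyticRank = 0) (hss : GoodSS W 2) (ha : W.frobeniusTrace 2 = 0)
    (hAr : A.analyticRank = 0) (hAss : GoodSS A 2) (hAa : A.frobeniusTrace 2 = 0)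
    (hTam : ¬ 2 ∣ A.tamagawaProduct) (hSha : ¬ 2 ∣ A.shaOrder)
    (e : WeierstrassCurve.geomTorsion W (2 : ℤ) ≃+ WeierstrassCurve.geomTorsion A (2 : ℤ))
    (he : ∀ (σ : Field.absoluteGaloisGroup ℚ) (P : WeierstrassCurve.geomTorsion W (2 : ℤ)), e (σ • P) = σ • e P)
    (hEC : ∀ (κ : ZpExtension ℚ 2) (γ : Field.absoluteGaloisGroup ℚ),
          κ.IsCyclotomic → κ.IsTopGenerator γ → Finite (W.selmerGroupPInfty 2) →
          Finite (endInvariants (conjSignedSelmerInfty W κ 1 γ - 1)) ∧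
            ∃ u : ℤ_[2]ˣ, (Nat.card (endInvariants (conjSignedSelmerInfty W κ 1 γ - 1)) : ℚ_[2]) =
              ((u : ℤ_[2]) : ℚ_[2]) * ((2 : ℕ) : ℚ_[2]) ^ (padicValNat 2 W.tamagawaProduct) *
                (Nat.card (W.selmerGroupPInfty 2) : ℚ_[2]) *
                  (Nat.card (EndCoinvariants (conjSignedSelmerInfty W κ 1 γ - 1)) : ℚ_[2]))
    (hCK : ∀ (κ : ZpExtension ℚ 2) (γ : Field.absoluteGaloisGroup ℚ),
        κ.IsCyclotomic → κ.IsTopGenerator γ → IsCyclotomicVariable 2 γ →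
        ∀ [NeZero (W.conductorNorm ℤ)] (f : CuspForm (Gamma0 (W.conductorNorm ℤ)) 2),
          IsNewformOf W f → ∀ (ϖ : ℚ), (ϖ : ℝ) * W.realPeriodRat = plusPeriod f →
        ∀ (Lplus Lminus : IwasawaAlgebra 2), IsPollackPair f 2 Lplus Lminus →
        ∀ (D : SignedSelmerDualData W κ γ 1) [ContinuousSMul ℤ_[2] (W.tateModule 2)],
          ∃ (I : Kato2004.IwasawaH1Data W 2 κ γ) (Y : W.FineSelmerDualData κ γ)
            (P : Submodule (IwasawaAlgebra 2) (IwasawaAlgebra 2))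
            (loc : I.H →ₗ[IwasawaAlgebra 2] P) (toX : P →ₗ[IwasawaAlgebra 2] D.X)
            (δ : D.X →ₗ[IwasawaAlgebra 2] Y.X) (Z : Submodule (IwasawaAlgebra 2) I.H)
            (G : IwasawaAlgebra 2),
            Function.Exact loc toX ∧ Function.Exact toX δ ∧
            G ∈ Submodule.map (P.subtype ∘ₗ loc) Z ∧
            iwasawaToPowerSeries 2 G =
              PowerSeries.C (ϖ : ℚ_[2]) * iwasawaToPowerSeries 2 (kobayashiL 1 Lplus Lminus) ∧
            (∀ 𝔭 : PrimeSpectrum (IwasawaAlgebra 2), 𝔭.asIdeal.height = 1 →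
              PowerSeries.C (2 : ℤ_[2]) ∉ 𝔭.asIdeal →
              Literature.NumberTheory.EllipticCurves.Module.lengthAt (IwasawaAlgebra 2) Y.X 𝔭 ≤
                Literature.NumberTheory.EllipticCurves.Module.lengthAt (IwasawaAlgebra 2) (I.H ⧸ Z) 𝔭))
    (hECA : ∀ (κ : ZpExtension ℚ 2) (γ : Field.absoluteGaloisGroup ℚ),
          κ.IsCyclotomic → κ.IsTopGenerator γ → Finite (A.selmerGroupPInfty 2) →
          Finite (endInvariants (conjSignedSelmerInfty A κ 1 γ - 1)) ∧
            ∃ u : ℤ_[2]ˣ, (Nat.card (endInvariants (conjSignedSelmerInfty A κ 1 γ - 1)) : ℚ_[2]) =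
              ((u : ℤ_[2]) : ℚ_[2]) * ((2 : ℕ) : ℚ_[2]) ^ (padicValNat 2 A.tamagawaProduct) *
                (Nat.card (A.selmerGroupPInfty 2) : ℚ_[2]) *
                  (Nat.card (EndCoinvariants (conjSignedSelmerInfty A κ 1 γ - 1)) : ℚ_[2]))
    (hmuT : GoodSS W 2 → W.frobeniusTrace 2 = 0 → GoodSS A 2 → A.frobeniusTrace 2 = 0 →
      (∃ e : WeierstrassCurve.geomTorsion W (2 : ℤ) ≃+ WeierstrassCurve.geomTorsion A (2 : ℤ),
        ∀ (σ : Field.absoluteGaloisGroup ℚ) (P : WeierstrassCurve.geomTorsion W (2 : ℤ)), e (σ • P) = σ • e P) →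
      ∀ (κ : ZpExtension ℚ 2) (γ : Field.absoluteGaloisGroup ℚ), κ.IsCyclotomic → κ.IsTopGenerator γ →
      ∀ (D : SignedSelmerDualData W κ γ 1) (D' : SignedSelmerDualData A κ γ 1)
        [Module.Finite (IwasawaAlgebra 2) D.X] [Module.Finite (IwasawaAlgebra 2) D'.X],
        Module.IsTorsion (IwasawaAlgebra 2) D.X → Module.IsTorsion (IwasawaAlgebra 2) D'.X →
        D'.mu = 0 → D.mu = 0)
    (ℓ : ℕ)
    (hlamT : GoodSS W 2 → W.frobeniusTrace 2 = 0 → GoodSS A 2 → A.frobeniusTrace 2 = 0 →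
      (∃ e : WeierstrassCurve.geomTorsion W (2 : ℤ) ≃+ WeierstrassCurve.geomTorsion A (2 : ℤ),
        ∀ (σ : Field.absoluteGaloisGroup ℚ) (P : WeierstrassCurve.geomTorsion W (2 : ℤ)), e (σ • P) = σ • e P) →
      ∀ (κ : ZpExtension ℚ 2) (γ : Field.absoluteGaloisGroup ℚ), κ.IsCyclotomic → κ.IsTopGenerator γ →
      ∀ (D : SignedSelmerDualData W κ γ 1) (D' : SignedSelmerDualData A κ γ 1)
        [Module.Finite (IwasawaAlgebra 2) D.X] [Module.Finite (IwasawaAlgebra 2) D'.X],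
        Module.IsTorsion (IwasawaAlgebra 2) D.X → Module.IsTorsion (IwasawaAlgebra 2) D'.X →
        D.mu = 0 → D'.mu = 0 → lambdaInvariant 2 D.X = lambdaInvariant 2 D'.X + ℓ)
    {n : ℕ} (hn : Even n)
    (hMT : ∀ [NeZero (W.conductorNorm ℤ)] (f : CuspForm (Gamma0 (W.conductorNorm ℤ)) 2), IsNewformOf W f →
      ((mazurTateElement f 2 n).map (algebraMap ℚ (PadicAlgCl 2))).supNorm = 1 ∧
        layerLambda ((mazurTateElement f 2 n).map (algebraMap ℚ (PadicAlgCl 2))) = (2 ^ n - 1) / 3 + ℓ) :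
    BSDp W 2 :=
  SSUnitAnchor.bsdp_two_of_unitAnchor_of_reading W A hmod hGZK h124 hX0 hr hss ha hAr hAss hAa hTam hSha e he hEC hCK hECA
    hmuT ℓ hlamT (by
      intro κ γ hκ hγ hγ' _ f hf ϖ hϖ Lplus Lminus hPP G m hG
      obtain ⟨hμ, hl⟩ := reading_two_of_layerCertificate W h2 hss hn ℓ hMT κ γ hκ hγ hγ' f hf ϖ hϖ Lplus Lminus hPP G m hG
      exact ⟨hμ, hl.le⟩)

end Rekey

end SSMazurTate
end Summit.BirchSwinnertonDyer.BirchSwinnertonDyer.Theorems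

end
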